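/-
Copyright (c) 2026 the pub-hodgecm-mathlib formalisation cell (harness21).  Prover seat hodgecm-mathlib-K2E3-p27 (g2), R90-TF SLAB section S4
(Rogawski Ch. 13.1–2), hand S4#C-NORM (S4 instance half; S4 dealer K2E2-plan (g6) R90 bus 2026-09-04T16:09:54Z «make the file the BRIDGE … the S4 instance at
`epsLoc L Φ v`»); h413 = `stmt-HodgeConjecture-24833`.
-/
import Summits.HodgeConjecture.HodgeConjecture.Theorems.R90S4TwistedNormMap          -- ★ (K2E3-p27 g2): generic ε-conjugacy ∕ norm-map laws (brings ★ `Ch4Sec10`, ★ `Ch4Sec10Bridge`)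
import Summits.HodgeConjecture.HodgeConjecture.Theorems.R90S4TwistLocalInvolution    -- ★ (K2E3-p27 g2): `twistLocal_twistLocal_cm` (`ε_v ∘ ε_v = id`, `δ`-free CM form)
import Summits.HodgeConjecture.HodgeConjecture.Theorems.R90S4LocalBaseChangeDefs     -- ★ (K2E3-p14 g9): `GtLoc`, `epsLoc`, `IsEpsRealisation` (S4 FILE C definitions)
import Literature.NumberTheory.Automorphic.LocalUnitaryGroupCongr                    -- ★ `local_eq_unitaryGroupOfForm_map` (`U(J)(F_v) = U(c ⊗ 1, J ⊗ 1)(E_v)`)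
import HarnessLib

/-!
# R90 · S4 (Ch. 13.1–2) · C-NORM, local instance — `G_v = U(Φ)(L⁺_v)` IS the fixed group of `ε_v` inside `G̃_v = GL_n(L ⊗ L⁺_v)`; norms of elements of `G_v`;
# «`γ ∈ 𝒩(δ)`» in S4 FILE C's carriers (`GtLoc L v`, `(cmDatum L 3 Φ).Local v`, `epsLoc L Φ v`)

Cell `pub/hodgecm-mathlib`, crux H413 = `stmt-HodgeConjecture-24833`, route of record `HCCMUnconditional`; R90-TF SLAB section S4 (S4 dealer K2E2-plan (g6); chair
K2-lead (g2)).  Lane `--kind definition --supports stmt-HodgeConjecture-24833 --as helper` (ONE `def`: `IsEpsNormPair`, the dealer's name, + theorems); no `instance`, no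
`notation`, no named-fact hypothesis, no `sorry`; namespace `Summit.HodgeConjecture.HodgeConjecture.R90.S4`.

WHAT.  The companion ★ `Theorems/R90S4TwistedNormMap.lean` proves the §1.4 ∕ §3.11 bookkeeping for an ABSTRACT `ε : G̃ →* G̃` (ε-conjugacy is an equivalence
relation, `N(y δ ε(y)⁻¹) = y N(δ) y⁻¹`, conjugate ε-centralizers, R90 ↔ Kottwitz).  Here it is read on the CONCRETE local data of the programme:
* §1 (any `E ∕ F`, `c ∈ Aut_F(E)`, `Φ ∈ GL_n(E)`, finite `v`): **`twistLocal_eq_self_iff_mem_local : ε_v(g) = g ↔ g ∈ U(Φ)(F_v)`** — the local unitary group ★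
  `UnitaryGroup.«local» E c n Φ v` IS the fixed subgroup of the local twist ★ `twistLocal E n Φ c v` (★ `Ch4Sec10Bridge.unitaryTwist_eq_self_iff_mem_unitaryGroup` read
  through ★ `local_eq_unitaryGroupOfForm_map`; print §3.10 p. 33 «we identify `G̃` with `G(E)` … `G = {g : ε(g) = g}`»); hence `epsNorm_twistLocal_of_mem_local : N(γ) = γ²` for
  `γ ∈ G_v` (§3.11: «if `δ ∈ G`, `N(δ) = δ²`»-type identity) and `mem_epsCentralizer_twistLocal_iff_of_mem_local : γ′ ∈ G̃_{γε} ↔ γ′ γ = γ γ′` for `γ′ ∈ G_v`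
  (`G_v ∩ G̃_{γε} = (G_v)_γ`);
* §2 (CM instance `L ∕ L⁺`, `n = 3`, S4 FILE C's ★ `GtLoc L v`, ★ `epsLoc L Φ v`, `G_v = (cmDatum L 3 Φ).Local v`): the same three facts at `epsLoc`, and
  **`IsEpsNormPair L Φ v δ γ`** := «`γ ∈ 𝒩(δ)`» = `IsConj (N δ) γ` in `G̃_v` for `δ : GtLoc L v`, `γ : G_v` (the ★ `Ch4Sec10.IsEpsNorm` shape on FILE C's carriers — ★ `IsEpsNorm`
  types `γ` over ★ `ShimuraVarieties.unitaryGroup σ Φ_v`, a different rendering of the same subgroup; `isEpsNormPair_iff` unfolds it), with the §3.11 laws transported from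
  the companion file: `isEpsNormPair_of_isEpsConj` (the `δ`-slot is ε-class invariant; `Φ` hermitian, via ★ `twistLocal_twistLocal_cm`), `isEpsNormPair_of_isConj`
  (the `γ`-slot is `G_v`-conjugacy invariant), `isConj_epsNorm_of_isEpsNormPair_of_isEpsNormPair` (two `δ`'s with a common norm have conjugate norms = are stably
  ε-conjugate), `isEpsNormPair_sq` (`γ² ∈ 𝒩(γ)` for `γ ∈ G_v ⊂ G̃_v`).
These are the C-D2 tokens of the twisted transfer `φ → f` ((4.10.2): «`Φ_ε^{st}(δ, φ) = Φ^{st}(γ, f)` whenever `γ ∈ 𝒩(δ)`»; S4 hand C-TT, K2E3-p36).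

HONEST LABEL.  Count-neutral helper (closes no socket); HC_CM is proved only modulo the 7 printed citations (2 remaining named inputs: hLiu418 =
`stmt-HodgeConjecture-24832`, h413 = `stmt-HodgeConjecture-24833`) until rung 0 closes; REL ≠ ★ ≠ BUILT.

## References
* [Rogawski1990] J. D. Rogawski, *Automorphic Representations of Unitary Groups in Three Variables*, Ann. of Math. Stud. 123 (1990): §1.4 p. 4, §3.10 p. 33
  («`ε` induces `σ` on `G(E)`»), §3.11 pp. 34–35 (`N(δ)`, `𝒩(δ)`, Prop. 3.11.1), §4.10 (4.10.1)–(4.10.2) pp. 57–58 (`φ → f`).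
* [Mok2014] C. P. Mok, *Endoscopic classification of representations of quasi-split unitary groups*, Mem. AMS 235 (2015), §1 Notation p. 5 (`U(N)(F_v) ⊂ GL_N(E ⊗ F_v)`).
-/

set_option autoImplicit false
-- the mandated namespace repeats `HodgeConjecture.HodgeConjecture`, as in every `Theorems/*.lean` of this sub-problem
set_option linter.dupNamespace false

noncomputable section

open NumberField IsDedekindDomain
open scoped MatrixGroups Matrix

namespace Summit.HodgeConjecture.HodgeConjecture.R90.S4

open Literature.NumberTheory.Rogawski1990.Ch4Sec10
open Literature.NumberTheory.Automorphic Literature.NumberTheory.Automorphic.UnitaryGroup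
open Summit.HodgeConjecture.HodgeConjecture.Cruxes.H413.K2E1GlobalTestFunctionsTwisted (formLocal twistLocal)

/-! ## §1 Any `E ∕ F`: `U(Φ)(F_v)` is the fixed group of `ε_v`; norms and ε-centralizers of its elements -/

section Generic

variable {F : Type} (E : Type) [Field F] [NumberField F] [Field E] [NumberField E] [Algebra F E] (n : ℕ) (Φ : GL (Fin n) E) (c : E ≃ₐ[F] E)
  (v : HeightOneSpectrum (𝓞 F))

/-- **`ε_v(g) = g ↔ g ∈ U(Φ)(F_v)`**: the local unitary group ★ `«local» E c n Φ v = {g ∈ GL_n(E_v) : ((c ⊗ 1) g)ᵀ Φ g = Φ}` is EXACTLY the fixed subgroup of the local twist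
`ε_v(g) = Φ⁻¹((σ_v g)ᵀ)⁻¹Φ` (★ `unitaryTwist_eq_self_iff_mem_unitaryGroup` over `E_v`, ★ `local_eq_unitaryGroupOfForm_map`; print: «we identify `G̃` with `G(E)` … `ε` induces `σ`»,
so `G(F) = G̃(F)^ε`). [cite: Rogawski1990, §3.10 p. 33] [cite: Mok2014, §1 Notation p. 5] -/
theorem twistLocal_eq_self_iff_mem_local (g : GL (Fin n) (LocalRing E v)) :
    twistLocal E n Φ c v g = g ↔ g ∈ «local» E c n (Φ : Matrix (Fin n) (Fin n) E) v := by
  rw [local_eq_unitaryGroupOfForm_map, mem_unitaryGroupOfForm_iff]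
  exact unitaryTwist_eq_self_iff_mem_unitaryGroup (conjLocal E c v) (formLocal E n Φ v) g

variable {E n Φ c v} in
/-- `ε_v(γ) = γ` for `γ ∈ U(Φ)(F_v)`. [cite: Rogawski1990, §3.10 p. 33] -/
theorem twistLocal_apply_of_mem_local {g : GL (Fin n) (LocalRing E v)} (hg : g ∈ «local» E c n (Φ : Matrix (Fin n) (Fin n) E) v) :
    twistLocal E n Φ c v g = g :=
  (twistLocal_eq_self_iff_mem_local E n Φ c v g).2 hg

variable {E n Φ c v} in
/-- **`N(γ) = γ²` for `γ ∈ G_v`**: the norm `N(δ) = δ ε(δ)` of an element of the unitary group is its square. [cite: Rogawski1990, §3.11 p. 34] -/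
theorem epsNorm_twistLocal_of_mem_local {g : GL (Fin n) (LocalRing E v)} (hg : g ∈ «local» E c n (Φ : Matrix (Fin n) (Fin n) E) v) :
    epsNorm (twistLocal E n Φ c v) g = g * g := by
  change g * twistLocal E n Φ c v g = g * g
  rw [twistLocal_apply_of_mem_local hg]

variable {E n Φ c v} in
/-- **`G_v ∩ G̃_{γε} = (G_v)_γ`**: an element `g` of the unitary group lies in the ε-centralizer of `γ` iff it commutes with `γ` (`g γ ε(g)⁻¹ = g γ g⁻¹`).
[cite: Rogawski1990, §1.4 p. 4; §3.11 p. 35] -/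
theorem mem_epsCentralizer_twistLocal_iff_of_mem_local {g : GL (Fin n) (LocalRing E v)} (hg : g ∈ «local» E c n (Φ : Matrix (Fin n) (Fin n) E) v)
    (γ : GL (Fin n) (LocalRing E v)) : g ∈ epsCentralizer (twistLocal E n Φ c v) γ ↔ g * γ = γ * g := by
  rw [mem_epsCentralizer_iff, twistLocal_apply_of_mem_local hg, mul_inv_eq_iff_eq_mul]

variable {E n Φ c v} in
/-- An element of `G_v` lies in its own ε-centralizer. [cite: Rogawski1990, §1.4 p. 4] -/
theorem mem_epsCentralizer_twistLocal_self_of_mem_local {g : GL (Fin n) (LocalRing E v)} (hg : g ∈ «local» E c n (Φ : Matrix (Fin n) (Fin n) E) v) :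
    g ∈ epsCentralizer (twistLocal E n Φ c v) g :=
  (mem_epsCentralizer_twistLocal_iff_of_mem_local hg g).2 rfl

end Generic

/-! ## §2 The CM instance of S4 FILE C: `G̃_v = GtLoc L v`, `ε_v = epsLoc L Φ v`, `G_v = (cmDatum L 3 Φ).Local v`; «`γ ∈ 𝒩(δ)`» -/

section CM

variable (L : Type) [Field L] [NumberField L] [IsCMField L] (Φ : GL (Fin 3) L) (v : HeightOneSpectrum (𝓞 ↥(maximalRealSubfield L)))

/-- **`ε_v(g) = g ↔ g ∈ G_v`** at FILE C's `epsLoc` (`G_v = U(Φ)(L⁺_v)` = ★ `«local» L c 3 Φ v`, the carrier `(cmDatum L 3 Φ).Local v` by ★ `cmDatum_Local`).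
[cite: Rogawski1990, §3.10 p. 33] -/
theorem epsLoc_eq_self_iff_mem_local (g : GtLoc L v) :
    epsLoc L Φ v g = g ↔ g ∈ «local» L (IsCMField.complexConj L) 3 (Φ : Matrix (Fin 3) (Fin 3) L) v :=
  twistLocal_eq_self_iff_mem_local L 3 Φ (IsCMField.complexConj L) v g

/-- **`ε_v(γ) = γ` for `γ ∈ G_v`** (FILE C's carriers). [cite: Rogawski1990, §3.10 p. 33] -/
theorem epsLoc_apply_coe (γ : (UnitaryGroup.cmDatum L 3 (Φ : Matrix (Fin 3) (Fin 3) L)).Local v) :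
    epsLoc L Φ v (γ.val : GtLoc L v) = γ.val :=
  twistLocal_apply_of_mem_local γ.2

/-- **`N(γ) = γ²` for `γ ∈ G_v`** at `epsLoc`. [cite: Rogawski1990, §3.11 p. 34] -/
theorem epsNorm_epsLoc_coe (γ : (UnitaryGroup.cmDatum L 3 (Φ : Matrix (Fin 3) (Fin 3) L)).Local v) :
    epsNorm (epsLoc L Φ v) (γ.val : GtLoc L v) = γ.val * γ.val :=
  epsNorm_twistLocal_of_mem_local γ.2

/-- `γ′ ∈ G̃_{γε} ↔ γ′ γ = γ γ′` for `γ′ ∈ G_v` at `epsLoc`. [cite: Rogawski1990, §1.4 p. 4; §3.11 p. 35] -/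
theorem coe_mem_epsCentralizer_epsLoc_iff (γ' : (UnitaryGroup.cmDatum L 3 (Φ : Matrix (Fin 3) (Fin 3) L)).Local v) (γ : GtLoc L v) :
    (γ'.val : GtLoc L v) ∈ epsCentralizer (epsLoc L Φ v) γ ↔ γ'.val * γ = γ * γ'.val :=
  mem_epsCentralizer_twistLocal_iff_of_mem_local γ'.2 γ

/-- **«`γ ∈ 𝒩(δ)`» in FILE C's carriers**: for `δ ∈ G̃_v = GtLoc L v` and `γ ∈ G_v = (cmDatum L 3 Φ).Local v`, the norm `N(δ) = δ ε_v(δ)` (★ `Ch4Sec10.epsNorm (epsLoc L Φ v) δ`)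
is `G̃_v`-conjugate to `γ` (Mathlib `IsConj`) — ★ `Ch4Sec10.IsEpsNorm`'s body («`γ` is a norm of `δ`: the stable conjugacy class of `N(δ)` meets `G` in `𝒩(δ) ∋ γ`», stable =
`GL_n`-conjugacy in the tree) with `γ` typed over FILE C's `G_v` instead of ★ `ShimuraVarieties.unitaryGroup`.  The dealer's name (R90 bus 16:09:54Z).
[cite: Rogawski1990, §3.11 p. 34; §4.10 (4.10.2) p. 58] -/
def IsEpsNormPair (δ : GtLoc L v) (γ : (UnitaryGroup.cmDatum L 3 (Φ : Matrix (Fin 3) (Fin 3) L)).Local v) : Prop :=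
  IsConj (epsNorm (epsLoc L Φ v) δ) (γ.val : GtLoc L v)

variable {L Φ v}

/-- Unfolding of `IsEpsNormPair`. [cite: Rogawski1990, §3.11 p. 34] -/
theorem isEpsNormPair_iff (δ : GtLoc L v) (γ : (UnitaryGroup.cmDatum L 3 (Φ : Matrix (Fin 3) (Fin 3) L)).Local v) :
    IsEpsNormPair L Φ v δ γ ↔ IsConj (epsNorm (epsLoc L Φ v) δ) (γ.val : GtLoc L v) :=
  Iff.rfl

/-- **`γ² ∈ 𝒩(γ)` for `γ ∈ G_v ⊂ G̃_v`** (`N(γ) = γ²`). [cite: Rogawski1990, §3.11 p. 34] -/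
theorem isEpsNormPair_sq (γ : (UnitaryGroup.cmDatum L 3 (Φ : Matrix (Fin 3) (Fin 3) L)).Local v) : IsEpsNormPair L Φ v γ.val (γ * γ) := by
  rw [isEpsNormPair_iff, epsNorm_epsLoc_coe]
  exact IsConj.refl _

/-- **The `γ`-slot of «`γ ∈ 𝒩(δ)`» is `G_v`-conjugacy invariant** (`𝒩(δ)` is a union of classes). [cite: Rogawski1990, §3.11 p. 34] -/
theorem isEpsNormPair_of_isConj {δ : GtLoc L v} {γ γ' : (UnitaryGroup.cmDatum L 3 (Φ : Matrix (Fin 3) (Fin 3) L)).Local v} (h : IsEpsNormPair L Φ v δ γ)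
    (hγ : IsConj γ γ') : IsEpsNormPair L Φ v δ γ' :=
  IsConj.trans h ((«local» L (IsCMField.complexConj L) 3 (Φ : Matrix (Fin 3) (Fin 3) L) v).subtype.map_isConj hγ)

/-- The `γ`-slot is also invariant under `G̃_v`-conjugation of `γ` inside `G_v` (the STABLE-class reading of `𝒩(δ)`). [cite: Rogawski1990, §3.11 p. 34] -/
theorem isEpsNormPair_of_isConj_val {δ : GtLoc L v} {γ γ' : (UnitaryGroup.cmDatum L 3 (Φ : Matrix (Fin 3) (Fin 3) L)).Local v} (h : IsEpsNormPair L Φ v δ γ)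
    (hγ : IsConj (γ.val : GtLoc L v) γ'.val) : IsEpsNormPair L Φ v δ γ' :=
  IsConj.trans h hγ

/-- **The `δ`-slot of «`γ ∈ 𝒩(δ)`» is ε-class invariant** for a hermitian `Φ` (`((Φ)ᵀ).map c = Φ`, so `ε_v ∘ ε_v = id` by ★ `twistLocal_twistLocal_cm`): `δ ~_ε δ′` and `γ ∈ 𝒩(δ)`
give `γ ∈ 𝒩(δ′)` (★ `isConj_epsNorm_of_isEpsConj`: `N(δ′) ~ N(δ) ~ γ`). [cite: Rogawski1990, §3.11 p. 34] -/
theorem isEpsNormPair_of_isEpsConj (hΦ : ((Φ : GL (Fin 3) L) : Matrix (Fin 3) (Fin 3) L)ᵀ.map (IsCMField.complexConj L) = (Φ : Matrix (Fin 3) (Fin 3) L))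
    {δ δ' : GtLoc L v} {γ : (UnitaryGroup.cmDatum L 3 (Φ : Matrix (Fin 3) (Fin 3) L)).Local v} (h : IsEpsNormPair L Φ v δ γ)
    (hc : IsEpsConj (epsLoc L Φ v) δ δ') : IsEpsNormPair L Φ v δ' γ :=
  (isConj_epsNorm_of_isEpsConj (twistLocal_twistLocal_cm L 3 Φ hΦ v) hc).symm.trans h

/-- **Two `δ`'s with a common norm `γ` have conjugate norms** (are stably ε-conjugate; the fibres of `𝒩` are stable ε-classes — injectivity half of Prop. 3.11.1 (c)).
[cite: Rogawski1990, §3.11 Prop. 3.11.1 (c) p. 34] -/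
theorem isConj_epsNorm_of_isEpsNormPair_of_isEpsNormPair {δ δ' : GtLoc L v} {γ : (UnitaryGroup.cmDatum L 3 (Φ : Matrix (Fin 3) (Fin 3) L)).Local v}
    (h : IsEpsNormPair L Φ v δ γ) (h' : IsEpsNormPair L Φ v δ' γ) : IsConj (epsNorm (epsLoc L Φ v) δ) (epsNorm (epsLoc L Φ v) δ') :=
  IsConj.trans h (IsConj.symm h')

/-- **ε-conjugate `δ`'s have conjugate norms** at `epsLoc` (hermitian `Φ`): `N` descends to `𝒪_ε(G̃_v) → 𝒪(G̃_v)`. [cite: Rogawski1990, §3.11 p. 34] -/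
theorem isConj_epsNorm_epsLoc_of_isEpsConj (hΦ : ((Φ : GL (Fin 3) L) : Matrix (Fin 3) (Fin 3) L)ᵀ.map (IsCMField.complexConj L) = (Φ : Matrix (Fin 3) (Fin 3) L))
    {δ δ' : GtLoc L v} (hc : IsEpsConj (epsLoc L Φ v) δ δ') : IsConj (epsNorm (epsLoc L Φ v) δ) (epsNorm (epsLoc L Φ v) δ') :=
  isConj_epsNorm_of_isEpsConj (twistLocal_twistLocal_cm L 3 Φ hΦ v) hc

/-- **`N(y δ ε_v(y)⁻¹) = y N(δ) y⁻¹`** at `epsLoc` (hermitian `Φ`). [cite: Rogawski1990, §3.11 p. 34] -/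
theorem epsNorm_epsLoc_mul_mul_inv (hΦ : ((Φ : GL (Fin 3) L) : Matrix (Fin 3) (Fin 3) L)ᵀ.map (IsCMField.complexConj L) = (Φ : Matrix (Fin 3) (Fin 3) L))
    (y δ : GtLoc L v) : epsNorm (epsLoc L Φ v) (y * δ * (epsLoc L Φ v y)⁻¹) = y * epsNorm (epsLoc L Φ v) δ * y⁻¹ :=
  epsNorm_mul_mul_inv (epsLoc L Φ v) (twistLocal_twistLocal_cm L 3 Φ hΦ v) y δ

end CM

end Summit.HodgeConjecture.HodgeConjecture.R90.S4

end
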